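import Summits.Schanuel.Schanuel.Theorems.DiophantineDichotomyApproximationPropertyCycleAPIAt3SatelliteDichotomy
import Mathlib.GroupTheory.CosetCover
import HarnessLib

/-!
# A fourth form through the orbit, or an enveloping satellite (crux `ApproximationProperty`, stmt-Schanuel-6117)

Crux `stmt-Schanuel-6117` (`Summit.Schanuel.Schanuel.Theses.DiophantineDichotomy.ApproximationProperty`),
route `DiophantineDichotomy`, line `orbit-interpolation-determinant`, lead c8
(`prover-line-stmt-Schanuel-6117-c8-0`), skeleton v19 (`Cruxes/ApproximationProperty/Lines/orbit_interpolation_determinant.lean`).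
Registered sub-goal `fourthForm_or_enveloped` (`--supports stmt-Schanuel-6117`).

Pure commutative algebra of `ℚ[x₀, …, x₃]`, sharpening the landed satellite dichotomy
(`satellite_dichotomy`, …CycleAPIAt3SatelliteDichotomy.lean): let `(Q)` be a prime surface, `P ∉ (Q)`,
so that `(Q, P)` is a complete-intersection curve all of whose minimal primes have `dim = 2`
(Macaulay, `SpaceCI.ringKrullDim_quotient_eq_two`), `T` a third form and `𝔭 ⊇ (Q, P, T)` a prime of
`dim ℚ[x̲]/𝔭 = 1` (a Galois orbit of points). Fix a level `ν₄`. Then EITHER some form `g ∈ 𝔭` of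
degree `ν₄` makes `𝔭` a MINIMAL prime of the four-generated ideal `(Q, P, T, g)` — an isolated point
of four hypersurfaces, to which Chardin–Philippon's regularity theorem applies with `k = 4` — OR some
satellite `𝔮'` (a homogeneous prime of `dim = 2`, minimal over `(Q, P)`, with `(Q, P, T) ≤ 𝔮' < 𝔭`)
ENVELOPS the orbit at level `ν₄`: every form of degree `ν₄` vanishing on the orbit vanishes on the
satellite, `ℚ[x̲]_{ν₄} ∩ 𝔭 ⊆ 𝔮'`. Proof: the satellites through the orbit containing `T` are finitely
many (minimal primes of a Noetherian ideal); if none envelops, the finitely many proper subspaces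
`ℚ[x̲]_{ν₄} ∩ 𝔭 ∩ 𝔮'` do not cover the `ℚ`-vector space `ℚ[x̲]_{ν₄} ∩ 𝔭` (`ℚ` is infinite,
`Subspace.biUnion_ne_univ_of_top_notMem`), which gives `g`; a prime strictly between `(Q, P, T, g)`
and `𝔭` would be a satellite containing `g` (dimension count as in `satellite_dichotomy`).

Main results: `FourthForm.minimal_or_satellite` (the dichotomy for any ideal between `(Q, P)` and
`𝔭`), `FourthForm.satellite_facts`, `fourthForm_or_enveloped`.

Sources: NesterenkoPhilippon2001 (LNM 1752) Ch. 10 §3 (Macaulay unmixedness); ChardinPhilippon1999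
(where the fourth form is consumed); folklore (a vector space over an infinite field is not a finite
union of proper subspaces).
-/

noncomputable section

-- `Summit.Schanuel.Schanuel.…` is the mandated summit/sub-problem namespace (single-conjunct summit), hence:
set_option linter.dupNamespace false

attribute [local instance] MvPolynomial.gradedAlgebra

namespace Summit.Schanuel.Schanuel.Cruxes.ApproximationProperty.OrbitInterpolationDeterminant

open Literature.NumberTheory.Transcendental.Nesterenko MvPolynomial
open scoped BigOperators

namespace FourthForm

/-- The ideal generated by the quadruple `![Q, P, T, g]` is `(Q) + (P) + (T) + (g)`. [folklore] -/
theorem span_range_four (Q P T g : Rx 3) :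
    Ideal.span (Set.range ![Q, P, T, g]) =
      Ideal.span {Q} ⊔ Ideal.span {P} ⊔ Ideal.span {T} ⊔ Ideal.span {g} := by
  rw [Matrix.range_cons, Matrix.range_cons, Matrix.range_cons, Matrix.range_cons, Matrix.range_empty,
    Set.union_empty]
  simp only [Set.singleton_union]
  rw [show ({Q, P, T, g} : Set (Rx 3)) = {Q} ∪ ({P} ∪ ({T} ∪ {g})) by rfl, Ideal.span_union,
    Ideal.span_union, Ideal.span_union]
  simp only [sup_assoc]

variable {Q P : Rx 3} {a b : ℕ}

/-- **Facts about a minimal prime of the c.i. curve `(Q, P)`**: it is prime, homogeneous, of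
`dim ℚ[x̲]/𝔮' = 2` (Macaulay unmixedness: minimal primes are associated), hence unmixed of rank `2`,
and it is never equal to a prime of `dim = 1`.
[cite: NesterenkoPhilippon2001, Ch. 10 §3 (proof of Prop. 3.6)] -/
theorem satellite_facts (hQ0 : Q ≠ 0) (hQ : Q.IsHomogeneous a) (hP : P.IsHomogeneous b)
    (ha : 1 ≤ a) (hb : 1 ≤ b) (hprime : (Ideal.span {Q}).IsPrime) (hPQ : P ∉ Ideal.span {Q})
    {𝔮' : Ideal (Rx 3)} (h𝔮' : 𝔮' ∈ (Ideal.span {Q} ⊔ Ideal.span {P}).minimalPrimes) :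
    𝔮'.IsPrime ∧ 𝔮'.IsHomogeneous (homogeneousSubmodule (Fin (3 + 1)) ℚ) ∧
      ringKrullDim (Rx 3 ⧸ 𝔮') = (2 : ℕ) ∧ IsUnmixedOfRank 𝔮' 2 ∧
      ∀ 𝔭 : Ideal (Rx 3), 𝔭.IsPrime → IsUnmixedOfRank 𝔭 1 → 𝔮' ≠ 𝔭 := by
  haveI h𝔮'prime : 𝔮'.IsPrime := h𝔮'.1.1
  have hJ₂hom : (Ideal.span {Q} ⊔ Ideal.span {P}).IsHomogeneous (homogeneousSubmodule (Fin (3 + 1)) ℚ) :=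
    (SpaceCI.isHomogeneous_span hQ).sup (SpaceCI.isHomogeneous_span hP)
  have h𝔮'hom : 𝔮'.IsHomogeneous (homogeneousSubmodule (Fin (3 + 1)) ℚ) :=
    Literature.RingTheory.MvPolynomial.isHomogeneous_of_mem_minimalPrimes hJ₂hom h𝔮'
  have h𝔮'ass : 𝔮' ∈ associatedPrimes (Rx 3) (Rx 3 ⧸ (Ideal.span {Q} ⊔ Ideal.span {P})) := by
    have h := Module.associatedPrimes.minimalPrimes_annihilator_subset_associatedPrimes
      (R := Rx 3) (M := Rx 3 ⧸ (Ideal.span {Q} ⊔ Ideal.span {P}))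
    rw [Ideal.annihilator_quotient] at h
    exact h h𝔮'
  have hdim : ringKrullDim (Rx 3 ⧸ 𝔮') = (2 : ℕ) :=
    SpaceCI.ringKrullDim_quotient_eq_two hQ0 hQ hP ha hb hprime hPQ h𝔮'ass
  refine ⟨h𝔮'prime, h𝔮'hom, hdim, isUnmixedOfRank_of_isPrime h𝔮'prime hdim, ?_⟩
  rintro 𝔭 h𝔭 hunm rfl
  have h1 : ringKrullDim (Rx 3 ⧸ 𝔮') = (1 : ℕ) := rank_eq_one h𝔭 hunm
  rw [hdim] at h1
  have h' : (2 : ℕ) = 1 := by exact_mod_cast h1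
  omega

/-- **Minimal, or above a satellite** — the satellite dichotomy for ANY ideal `J` between the c.i.
curve `(Q, P)` and the orbit `𝔭` (`dim ℚ[x̲]/𝔭 = 1`): either `𝔭` is a minimal prime of `J`, or
there is a satellite `𝔮'` — prime, homogeneous, `dim = 2`, minimal over `(Q, P)` — with
`J ≤ 𝔮' < 𝔭`. (The landed `satellite_dichotomy` is the case `J = (Q, P, T)`.)
[cite: NesterenkoPhilippon2001, Ch. 10 §3 (proof of Prop. 3.6); Matsumura1987, Thm 5.6] -/
theorem minimal_or_satellite (hQ0 : Q ≠ 0) (hQ : Q.IsHomogeneous a) (hP : P.IsHomogeneous b)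
    (ha : 1 ≤ a) (hb : 1 ≤ b) (hprime : (Ideal.span {Q}).IsPrime) (hPQ : P ∉ Ideal.span {Q})
    {J : Ideal (Rx 3)} (hJ₂ : Ideal.span {Q} ⊔ Ideal.span {P} ≤ J)
    {𝔭 : Ideal (Rx 3)} (h𝔭 : 𝔭.IsPrime) (hunm : IsUnmixedOfRank 𝔭 1) (hle : J ≤ 𝔭) :
    𝔭 ∈ J.minimalPrimes ∨
    ∃ 𝔮' : Ideal (Rx 3), 𝔮'.IsPrime ∧ 𝔮'.IsHomogeneous (homogeneousSubmodule (Fin (3 + 1)) ℚ) ∧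
      IsUnmixedOfRank 𝔮' 2 ∧ 𝔮' ∈ (Ideal.span {Q} ⊔ Ideal.span {P}).minimalPrimes ∧
      J ≤ 𝔮' ∧ 𝔮' < 𝔭 := by
  set J₂ : Ideal (Rx 3) := Ideal.span {Q} ⊔ Ideal.span {P} with hJ₂def
  obtain ⟨𝔮', h𝔮'min, h𝔮'le⟩ := Ideal.exists_minimalPrimes_le hle
  by_cases heq : 𝔮' = 𝔭
  · exact Or.inl (heq ▸ h𝔮'min)
  · right
    have hlt : 𝔮' < 𝔭 := lt_of_le_of_ne h𝔮'le heq
    haveI h𝔮'prime : 𝔮'.IsPrime := h𝔮'min.1.1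
    haveI := h𝔭
    -- a minimal prime `𝔮₂ ≤ 𝔮'` of the c.i. `(Q, P)` has `dim = 2`
    have hJ₂le : J₂ ≤ 𝔮' := hJ₂.trans h𝔮'min.1.2
    obtain ⟨𝔮₂, h𝔮₂min, h𝔮₂le⟩ := Ideal.exists_minimalPrimes_le hJ₂le
    obtain ⟨h𝔮₂prime, h𝔮₂hom, hdim₂, h𝔮₂unm, -⟩ := satellite_facts hQ0 hQ hP ha hb hprime hPQ h𝔮₂min
    -- `dim/𝔭 = 1`, so `2 ≤ dim/𝔮' ≤ dim/𝔮₂ = 2`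
    have hdim𝔭 : ringKrullDim (Rx 3 ⧸ 𝔭) = (1 : ℕ) := rank_eq_one h𝔭 hunm
    have hlow : ((2 : ℕ) : WithBot ℕ∞) ≤ ringKrullDim (Rx 3 ⧸ 𝔮') := by
      have h := SatelliteDichotomy.ringKrullDim_quotient_add_one_le_of_lt hlt
      rw [hdim𝔭] at h
      exact le_trans (by exact_mod_cast le_rfl) h
    have hup : ringKrullDim (Rx 3 ⧸ 𝔮') ≤ ((2 : ℕ) : WithBot ℕ∞) := by
      rw [← hdim₂]
      exact ringKrullDim_le_of_surjective (Ideal.Quotient.factor h𝔮₂le)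
        (Ideal.Quotient.factor_surjective h𝔮₂le)
    have hdim' : ringKrullDim (Rx 3 ⧸ 𝔮') = (2 : ℕ) := le_antisymm hup hlow
    -- hence `𝔮₂ = 𝔮'`
    have heq₂ : 𝔮₂ = 𝔮' := by
      by_contra hne
      haveI := h𝔮₂prime
      have hlt₂ : 𝔮₂ < 𝔮' := lt_of_le_of_ne h𝔮₂le hne
      have h := SatelliteDichotomy.ringKrullDim_quotient_add_one_le_of_lt hlt₂
      rw [hdim', hdim₂] at h
      have h' : (2 : ℕ) + 1 ≤ 2 := by exact_mod_cast h
      omega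
    subst heq₂
    exact ⟨_, h𝔮₂prime, h𝔮₂hom, h𝔮₂unm, h𝔮₂min, h𝔮'min.1.2, hlt⟩

end FourthForm

/-- **Registered sub-goal `fourthForm_or_enveloped`** (skeleton v19, lead c8): for the c.i. curve
`(Q, P)` of `ℚ[x₀, …, x₃]` (`(Q)` prime of degree `a ≥ 1`, `P ∉ (Q)` of degree `b ≥ 1`), a third
form `T` of degree `τ ≥ 1`, an orbit `𝔭 ⊇ (Q, P, T)` (homogeneous prime of rank `1`) and a level
`ν₄`: EITHER there is a form `g ∈ 𝔭` of degree `ν₄` such that `𝔭` is a minimal prime of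
`(Q, P, T, g)` (an isolated point of four hypersurfaces — Chardin–Philippon then gives the
interpolation clause from degree `a + b + τ + ν₄ − 3` on), OR some satellite `𝔮'` (homogeneous prime,
unmixed of rank `2`, minimal over `(Q, P)`, `(Q, P, T) ≤ 𝔮' < 𝔭`) ENVELOPS the orbit at level
`ν₄`: `ℚ[x̲]_{ν₄} ∩ 𝔭 ⊆ 𝔮'`. Proof: finitely many satellites; subspace avoidance over the infinite
field `ℚ`; `FourthForm.minimal_or_satellite` for `J = (Q, P, T, g)`.
[cite: NesterenkoPhilippon2001, Ch. 10 §3; ChardinPhilippon1999 (use)] -/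
theorem fourthForm_or_enveloped : ∀ (Q P T : Rx 3) (a b τ : ℕ), Q ≠ 0 → Q.IsHomogeneous a →
    P.IsHomogeneous b → T.IsHomogeneous τ → 1 ≤ a → 1 ≤ b → 1 ≤ τ →
    (Ideal.span {Q}).IsPrime → P ∉ Ideal.span {Q} →
    ∀ 𝔭 : Ideal (Rx 3), 𝔭.IsPrime → 𝔭.IsHomogeneous (homogeneousSubmodule (Fin (3 + 1)) ℚ) →
    IsUnmixedOfRank 𝔭 1 → Ideal.span {Q} ⊔ Ideal.span {P} ⊔ Ideal.span {T} ≤ 𝔭 → ∀ ν₄ : ℕ,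
    (∃ g : Rx 3, g ∈ homogeneousSubmodule (Fin (3 + 1)) ℚ ν₄ ∧ g ∈ 𝔭 ∧
      𝔭 ∈ (Ideal.span (Set.range ![Q, P, T, g])).minimalPrimes) ∨
    ∃ 𝔮' : Ideal (Rx 3), 𝔮'.IsPrime ∧ 𝔮'.IsHomogeneous (homogeneousSubmodule (Fin (3 + 1)) ℚ) ∧
      IsUnmixedOfRank 𝔮' 2 ∧ 𝔮' ∈ (Ideal.span {Q} ⊔ Ideal.span {P}).minimalPrimes ∧
      Ideal.span {Q} ⊔ Ideal.span {P} ⊔ Ideal.span {T} ≤ 𝔮' ∧ 𝔮' < 𝔭 ∧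
      homogeneousSubmodule (Fin (3 + 1)) ℚ ν₄ ⊓ 𝔭.restrictScalars ℚ ≤ 𝔮'.restrictScalars ℚ := by
  intro Q P T a b τ hQ0 hQ hP _hT ha hb _hτ hprime hPQ 𝔭 h𝔭 _hhom hunm hle ν₄
  classical
  set J₂ : Ideal (Rx 3) := Ideal.span {Q} ⊔ Ideal.span {P} with hJ₂def
  set W : Submodule ℚ (Rx 3) := homogeneousSubmodule (Fin (3 + 1)) ℚ ν₄ ⊓ 𝔭.restrictScalars ℚ
    with hWdef
  have hJ₂𝔭 : J₂ ≤ 𝔭 := le_sup_left.trans hle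
  have hT𝔭 : T ∈ 𝔭 := hle (Ideal.mem_sup_right (Ideal.mem_span_singleton_self T))
  by_cases henv : ∃ 𝔮' ∈ J₂.minimalPrimes, T ∈ 𝔮' ∧ 𝔮' ≤ 𝔭 ∧ W ≤ 𝔮'.restrictScalars ℚ
  · -- an enveloping satellite
    obtain ⟨𝔮', h𝔮'min, hT𝔮', h𝔮'𝔭, hW𝔮'⟩ := henv
    obtain ⟨h𝔮'prime, h𝔮'hom, -, h𝔮'unm, hne⟩ :=
      FourthForm.satellite_facts hQ0 hQ hP ha hb hprime hPQ h𝔮'min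
    refine Or.inr ⟨𝔮', h𝔮'prime, h𝔮'hom, h𝔮'unm, h𝔮'min, ?_, lt_of_le_of_ne h𝔮'𝔭 (hne 𝔭 h𝔭 hunm),
      hW𝔮'⟩
    exact sup_le h𝔮'min.1.2 ((Ideal.span_singleton_le_iff_mem _).mpr hT𝔮')
  · -- no satellite envelops: a form of degree `ν₄` in `𝔭` outside every satellite
    left
    push Not at henv
    -- the finite family of satellites through the orbit containing `T`
    have hfin : J₂.minimalPrimes.Finite := Ideal.finite_minimalPrimes_of_isNoetherianRing _ J₂
    set F : Finset (Ideal (Rx 3)) :=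
      hfin.toFinset.filter (fun 𝔮' => T ∈ 𝔮' ∧ 𝔮' ≤ 𝔭) with hFdef
    have hFmem : ∀ 𝔮' ∈ F, 𝔮' ∈ J₂.minimalPrimes ∧ T ∈ 𝔮' ∧ 𝔮' ≤ 𝔭 := fun 𝔮' h => by
      rw [hFdef, Finset.mem_filter, Set.Finite.mem_toFinset] at h
      exact ⟨h.1, h.2.1, h.2.2⟩
    -- their traces on `W`, proper subspaces of `W`
    set s : Finset (Submodule ℚ ↥W) :=
      F.image (fun 𝔮' => (𝔮'.restrictScalars ℚ).comap W.subtype) with hsdef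
    have htop : (⊤ : Submodule ℚ ↥W) ∉ s := by
      intro h
      rw [hsdef, Finset.mem_image] at h
      obtain ⟨𝔮', h𝔮'F, htopeq⟩ := h
      obtain ⟨h𝔮'min, hT𝔮', h𝔮'𝔭⟩ := hFmem 𝔮' h𝔮'F
      refine henv 𝔮' h𝔮'min hT𝔮' h𝔮'𝔭 fun w hw => ?_
      have : (⟨w, hw⟩ : ↥W) ∈ (𝔮'.restrictScalars ℚ).comap W.subtype := by
        rw [htopeq]; exact Submodule.mem_top
      simpa using this
    have hne := Subspace.biUnion_ne_univ_of_top_notMem htop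
    obtain ⟨w, hw⟩ := (Set.ne_univ_iff_exists_notMem _).mp hne
    have hwout : ∀ 𝔮' ∈ F, (w : Rx 3) ∉ 𝔮' := by
      intro 𝔮' h𝔮'F hw𝔮'
      apply hw
      simp only [Set.mem_iUnion]
      refine ⟨(𝔮'.restrictScalars ℚ).comap W.subtype, ?_, ?_⟩
      · rw [hsdef]; exact Finset.mem_image_of_mem _ h𝔮'F
      · simpa using hw𝔮'
    set g : Rx 3 := (w : Rx 3) with hgdef
    have hgW : g ∈ W := w.2
    have hgν : g ∈ homogeneousSubmodule (Fin (3 + 1)) ℚ ν₄ := (Submodule.mem_inf.mp hgW).1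
    have hg𝔭 : g ∈ 𝔭 := (Submodule.mem_inf.mp hgW).2
    refine ⟨g, hgν, hg𝔭, ?_⟩
    -- `𝔭` is minimal over `(Q, P, T, g)`: a satellite in between would contain `g`
    set J : Ideal (Rx 3) := Ideal.span (Set.range ![Q, P, T, g]) with hJdef
    have hJeq : J = J₂ ⊔ Ideal.span {T} ⊔ Ideal.span {g} := by
      rw [hJdef, FourthForm.span_range_four]
    have hJ₂J : J₂ ≤ J := by rw [hJeq]; exact le_sup_left.trans le_sup_left
    have hJle : J ≤ 𝔭 := by
      rw [hJeq]
      exact sup_le hle ((Ideal.span_singleton_le_iff_mem _).mpr hg𝔭)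
    rcases FourthForm.minimal_or_satellite hQ0 hQ hP ha hb hprime hPQ hJ₂J h𝔭 hunm hJle with
      hmin | ⟨𝔮', -, -, -, h𝔮'min, hJ𝔮', h𝔮'lt⟩
    · exact hmin
    · exfalso
      have hT𝔮' : T ∈ 𝔮' := by
        refine hJ𝔮' ?_
        rw [hJeq]
        exact Ideal.mem_sup_left (Ideal.mem_sup_right (Ideal.mem_span_singleton_self T))
      have hg𝔮' : g ∈ 𝔮' := by
        refine hJ𝔮' ?_
        rw [hJeq]
        exact Ideal.mem_sup_right (Ideal.mem_span_singleton_self g)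
      have h𝔮'F : 𝔮' ∈ F := by
        rw [hFdef, Finset.mem_filter, Set.Finite.mem_toFinset]
        exact ⟨h𝔮'min, hT𝔮', h𝔮'lt.le⟩
      exact hwout 𝔮' h𝔮'F hg𝔮'

end Summit.Schanuel.Schanuel.Cruxes.ApproximationProperty.OrbitInterpolationDeterminant

end
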